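import Summits.AnomalousDissipation.AnomalousDissipation.Theorems.SolenoidalFractalHomogenisationLagrangianStepCarrierFastContent
import Summits.AnomalousDissipation.AnomalousDissipation.Theorems.SolenoidalFractalHomogenisationLagrangianStepCellEnergyTDualLeak
import HarnessLib

/-!
# K1L `LagrangianRenormalisationStep(Design)` (K1L_D, stmt-AnomalousDissipation-27980; aside 24912), stub `stub_cellLawV0_IS`
# — W0: SECTOR REDUCTION of the slow-vector clause (V) — its left-hand side `2 Σᵢ |modeCoeff ℓ (w t − v t) i|²` IS the `L²` distance of the
# cell solution to the effective solution up to the corrector content of the cell solution (helper; `--supports stmt-AnomalousDissipation-27980`)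

Summits-side helper file of route `SolenoidalFractalHomogenisation` (planner ad-ideate-p5's STUB-PLAN for `stub_cellLawV` §1 (V) step V0 «sector /
Fourier reduction»; tenure planner ad-ideate-p1 WORKER FIT v2 item W0 `…LagrangianStepCellLawVSectorReduction.lean` «via `cell_sector_preservation`
(p634914/p635910) + `cell_corrector_content`»; director-frontier K-AD-L3), on top of `…LagrangianStepCarrierFastContent` (p639358,
`ae_complement_pair_energy_le`) and `…LagrangianStepCellCorrectorContent` (p634914: dictionary `modeCoeff`/`sectorEnergy` ↔ `mFourierCoeff`, cell
carrier facts).  In the setting of `SlowVectorClauseNoExF` (cell solution `w` of tensor `(1/n²)•𝔸` along `cellField W M hM ν _ n` and effective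
solution `v` of a constant elliptic tensor `𝔹` with NO carrier, both from the single-mode datum `Re e_ℓ·p`, `p ⊥ ℓ`, `ℓ ≠ 0`, `2|ℓᵢ| ≤ n`):
* §1 reality and Bessel for the pair `{±ℓ}`: `|𝓕f(ℓ)|² + |𝓕f(−ℓ)|² = 2 Σᵢ |modeCoeff ℓ f i|² ≤ ∫‖f‖²` (`pair_energy_eq_two_mul_sum`,
  `two_mul_sum_modeCoeff_le_integral`), and `∫‖f‖² = 2Σᵢ|modeCoeff ℓ f i|²` when every other coefficient vanishes;
* §2 THE EFFECTIVE SOLUTION LIVES ON `{±ℓ}`: `𝓕(v r)(k) = 0` for `k ≠ ±ℓ` and `∫‖v r‖² = 2Σᵢ|modeCoeff ℓ (v r) i|²` for a.e. `r`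
  (`carrierFree_mFourierCoeff_eq_zero`, `carrierFree_integral_norm_sq_eq`: Bloch-sector preservation `ae_mFourierCoeff_eq_zero_off_sector` of ad-lit's
  `PassiveVectorTensorSymmetry` for EVERY modulus, the zero carrier being invariant under every torsion grid);
* §3 THE CELL SOLUTION LIVES ON `{±ℓ} + nℤ³` with fast complement `∫‖w t‖² − 2Σᵢ|modeCoeff ℓ (w t) i|² ≤ (9k²λ²‖ℓ‖²/(π⁴n²ν²lo²))·E₀`
  (`cell_pair_complement_le`, = `ae_complement_pair_energy_le` along the cell carrier; the pair form of `cell_corrector_content`);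
* §4 THE REDUCTION: for a.e. `t`, `∫‖w t − v t‖² = 2Σᵢ|modeCoeff ℓ (w t − v t) i|² + (∫‖w t‖² − 2Σᵢ|modeCoeff ℓ (w t) i|²)` (`slowVector_integral_norm_sq_sub_eq`,
  Parseval), hence `2Σᵢ|modeCoeff ℓ (w t − v t) i|² ≤ ∫‖w t − v t‖² ≤ 2Σᵢ|modeCoeff ℓ (w t − v t) i|² + (9k²λ²‖ℓ‖²/(π⁴n²ν²lo²))·E₀`
  (`slowVector_sandwich`): clause (V) is `L²`-tracking of the effective solution modulo the corrector content (C), and its proof may be run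
  entirely on the slow pair `±ℓ` (the Floquet–Bloch heart: ODE for `modeCoeff ℓ (w t)` vs the explicit `e^{−tḠ}` of `modeCoeff ℓ (v t)` — NOT here).
No named facts, no new definitions, no sorry.  Infrastructure for route-1's rung leaf F-D1.A0 (frontier FORMAL rung); NOT a proof of the stub, of the
crux, of Onsager's conjecture or of anomalous dissipation.  Prover seat `ad-k1l-cellLawV-w1` g0, 2026-08-28.
-/

set_option linter.dupNamespace false

noncomputable section

namespace Summit.AnomalousDissipation.AnomalousDissipation.Theorems.SolenoidalFractalHomogenisation.LagrangianStep

open Literature.Analysis Literature.Analysis.FluidPDE Literature.Analysis.FunctionSpaces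
open Literature.Analysis.FluidPDE.LatticeShear
open MeasureTheory Set Filter Function UnitAddTorus
open scoped ENNReal NNReal InnerProductSpace
open Summit.AnomalousDissipation.AnomalousDissipation.Theorems.SolenoidalFractalHomogenisation.RealisedQuasiStaticCellLaw

/-! ## §1 The pair `{±ℓ}` of a real field: reality, Bessel, Parseval -/

section Pair

/-- Reality: `sectorEnergy (−ℓ) f = sectorEnergy ℓ f` (the coefficients at `−ℓ` are the conjugates of those at `ℓ`). [folklore] -/
theorem sectorEnergy_neg_eq {f : VF} (hf : Integrable f volume) (ℓ : Fin 3 → ℤ) : sectorEnergy (-ℓ) f = sectorEnergy ℓ f := by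
  rw [sectorEnergy_eq hf, sectorEnergy_eq hf, EuclideanSpace.norm_sq_eq, EuclideanSpace.norm_sq_eq]
  refine Finset.sum_congr rfl fun i _ => ?_
  rw [FunctionSpaces.Torus.mFourierCoeff_complexify_neg_apply hf, RCLike.norm_conj]

/-- The pair energy is twice the sector energy: `|𝓕f(ℓ)|² + |𝓕f(−ℓ)|² = 2 Σᵢ |modeCoeff ℓ f i|²`. [folklore] -/
theorem pair_energy_eq_two_mul_sum {f : VF} (hf : Integrable f volume) (ℓ : Fin 3 → ℤ) :
    ‖mFourierCoeff (FunctionSpaces.EuclideanSpace.complexify ∘ f) ℓ‖ ^ 2 +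
        ‖mFourierCoeff (FunctionSpaces.EuclideanSpace.complexify ∘ f) (-ℓ)‖ ^ 2 = 2 * ∑ i, ‖modeCoeff ℓ f i‖ ^ 2 := by
  rw [← sectorEnergy_eq hf, ← sectorEnergy_eq hf, sectorEnergy_neg_eq hf]
  unfold sectorEnergy
  ring

/-- Bessel for the pair: `2 Σᵢ |modeCoeff ℓ f i|² ≤ ∫‖f‖²` for `f ∈ L²`, `ℓ ≠ 0`. [folklore] -/
theorem two_mul_sum_modeCoeff_le_integral {f : VF} (hf : MemLp f 2 volume) {ℓ : Fin 3 → ℤ} (hℓ : ℓ ≠ 0) :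
    2 * ∑ i, ‖modeCoeff ℓ f i‖ ^ 2 ≤ ∫ x, ‖f x‖ ^ 2 := by
  classical
  have hfi : Integrable f volume := hf.integrable one_le_two
  have hne := CellEnergyT.ne_neg_of_ne_zero hℓ
  set S : Finset (Fin 3 → ℤ) := {ℓ, -ℓ} with hS_def
  have hS : ∀ k' ∈ S, -k' ∈ S := by
    intro k' hk'
    rcases Finset.mem_insert.1 hk' with rfl | hk'
    · exact Finset.mem_insert_of_mem (Finset.mem_singleton_self _)
    · rw [Finset.mem_singleton.1 hk', neg_neg]; exact Finset.mem_insert_self _ _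
  have hpars := Torus.integral_norm_sq_sub_realTrigPoly_coeff hS hf
  have h0 : 0 ≤ ∫ x, ‖f x - FunctionSpaces.Torus.realTrigPoly S
      (fun k' => mFourierCoeff (FunctionSpaces.EuclideanSpace.complexify ∘ f) k') x‖ ^ 2 :=
    integral_nonneg fun x => sq_nonneg _
  rw [← pair_energy_eq_two_mul_sum hfi]
  rw [hS_def, Finset.sum_pair hne] at hpars
  rw [hS_def] at h0
  linarith

/-- Parseval on the pair: if every coefficient off `{±ℓ}` vanishes then `∫‖f‖² = 2 Σᵢ |modeCoeff ℓ f i|²`. [folklore] -/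
theorem integral_norm_sq_eq_two_mul_sum {f : VF} (hf : MemLp f 2 volume) {ℓ : Fin 3 → ℤ} (hℓ : ℓ ≠ 0)
    (hz : ∀ k', k' ≠ ℓ → k' ≠ -ℓ → mFourierCoeff (FunctionSpaces.EuclideanSpace.complexify ∘ f) k' = 0) :
    ∫ x, ‖f x‖ ^ 2 = 2 * ∑ i, ‖modeCoeff ℓ f i‖ ^ 2 := by
  classical
  have hfi : Integrable f volume := hf.integrable one_le_two
  have hne := CellEnergyT.ne_neg_of_ne_zero hℓ
  have hP := FunctionSpaces.Torus.hasSum_sq_norm_mFourierCoeff_complexify hf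
  have hfin : HasSum (fun k' : Fin 3 → ℤ => ‖mFourierCoeff (FunctionSpaces.EuclideanSpace.complexify ∘ f) k'‖ ^ 2)
      (∑ k' ∈ ({ℓ, -ℓ} : Finset (Fin 3 → ℤ)), ‖mFourierCoeff (FunctionSpaces.EuclideanSpace.complexify ∘ f) k'‖ ^ 2) := by
    refine hasSum_sum_of_ne_finset_zero fun k' hk' => ?_
    have h1 : k' ≠ ℓ := fun h => hk' (h ▸ Finset.mem_insert_self _ _)
    have h2 : k' ≠ -ℓ := fun h => hk' (h ▸ Finset.mem_insert_of_mem (Finset.mem_singleton_self _))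
    rw [hz k' h1 h2, norm_zero, zero_pow two_ne_zero]
  rw [hP.unique hfin, Finset.sum_pair hne, pair_energy_eq_two_mul_sum hfi]

end Pair

/-! ## §2 The effective (carrier-free) solution lives on the pair `{±ℓ}` -/

section Effective

/-- **A carrier-free constant-tensor weak solution from the single-mode datum has no Fourier modes off `{±ℓ}`**: for `𝔹` elliptic
(`NearIso 𝔹 lo' hi'`, `lo' > 0`) and every weak solution `v` of `∂ₜv = 𝓛_𝔹 v + ∇π`, `∇·v = 0` from `Re e_ℓ·p`, for a.e. `r ∈ (0,T')`,
`𝓕(v r)(k) = 0` whenever `k ≠ ±ℓ` (Bloch-sector preservation for EVERY modulus `N`, the zero carrier being `N`-grid invariant; for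
`N > |kᵢ ± ℓᵢ|` the sector of `ℓ` modulo `N` meets `k` only at `±ℓ`). [folklore] -/
theorem carrierFree_mFourierCoeff_eq_zero {𝔹 : Torus.Visc4 (Fin 3)} {lo' hi' : ℝ} (hN : Torus.NearIso 𝔹 lo' hi') (hlo' : 0 < lo')
    (ℓ : Fin 3 → ℤ) (p : EuclideanSpace ℝ (Fin 3)) {T' : ℝ} {v : ℝ → VF}
    (hv : Torus.IsWeakTensorPassiveVectorOn 0 T' 𝔹 (fun _ _ => 0) (fun x => (UnitAddTorus.mFourier ℓ x).re • p) v) :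
    ∀ᵐ r ∂(volume.restrict (Ioo 0 T')), ∀ k', k' ≠ ℓ → k' ≠ -ℓ →
      mFourierCoeff (FunctionSpaces.EuclideanSpace.complexify ∘ v r) k' = 0 := by
  have hb : MemLp (FunctionSpaces.Torus.stLift (fun (_ : ℝ) (_ : UnitAddTorus (Fin 3)) => (0 : EuclideanSpace ℝ (Fin 3)))) ∞
      (volume.restrict (Ioo 0 T' ×ˢ (univ : Set (EuclideanSpace ℝ (Fin 3))))) := MemLp.zero'
  have hw₀2 : MemLp (fun x : UnitAddTorus (Fin 3) => (UnitAddTorus.mFourier ℓ x).re • p) 2 volume :=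
    memLp_two_of_memSobolev_one_complexify (memSobolev_one_singleMode ℓ p)
  -- sector preservation for every modulus `N + 1`
  have hsec : ∀ N : ℕ, ∀ᵐ r ∂(volume.restrict (Ioo 0 T')), ∀ k',
      ¬ ((∀ i, ((N + 1 : ℕ) : ℤ) ∣ k' i - ℓ i) ∨ (∀ i, ((N + 1 : ℕ) : ℤ) ∣ k' i + ℓ i)) →
      mFourierCoeff (FunctionSpaces.EuclideanSpace.complexify ∘ v r) k' = 0 := by
    intro N
    have hsuppSec : ∀ k', mFourierCoeff (FunctionSpaces.EuclideanSpace.complexify ∘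
        fun x : UnitAddTorus (Fin 3) => (UnitAddTorus.mFourier ℓ x).re • p) k' ≠ 0 →
        (∀ i, ((N + 1 : ℕ) : ℤ) ∣ k' i - ℓ i) ∨ (∀ i, ((N + 1 : ℕ) : ℤ) ∣ k' i + ℓ i) := by
      intro k' hk'
      by_cases h1 : k' = ℓ
      · exact Or.inl fun i => by rw [h1, sub_self]; exact dvd_zero _
      by_cases h2 : k' = -ℓ
      · exact Or.inr fun i => by rw [h2, Pi.neg_apply, neg_add_cancel]; exact dvd_zero _
      exact absurd (mFourierCoeff_singleMode_eq_zero ℓ p h1 h2) hk'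
    exact hv.ae_mFourierCoeff_eq_zero_off_sector (Nat.succ_pos N) ℓ hN hlo' hb (fun _ _ _ => rfl) hw₀2 hsuppSec
  rw [← ae_all_iff] at hsec
  filter_upwards [hsec] with r hr k' h1 h2
  -- a modulus exceeding every `|k'ᵢ − ℓᵢ|`, `|k'ᵢ + ℓᵢ|`
  obtain ⟨N, hN1⟩ : ∃ N : ℕ, ∀ i, (k' i - ℓ i).natAbs < N + 1 ∧ (k' i + ℓ i).natAbs < N + 1 := by
    refine ⟨∑ i, ((k' i - ℓ i).natAbs + (k' i + ℓ i).natAbs), fun i => ⟨?_, ?_⟩⟩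
    · have := Finset.single_le_sum (f := fun i => (k' i - ℓ i).natAbs + (k' i + ℓ i).natAbs)
        (fun i _ => Nat.zero_le _) (Finset.mem_univ i)
      omega
    · have := Finset.single_le_sum (f := fun i => (k' i - ℓ i).natAbs + (k' i + ℓ i).natAbs)
        (fun i _ => Nat.zero_le _) (Finset.mem_univ i)
      omega
  refine hr N k' ?_
  rintro (hd | hd)
  · apply h1
    funext i
    have hz : k' i - ℓ i = 0 :=
      Int.eq_zero_of_dvd_of_natAbs_lt_natAbs (hd i) (by rw [Int.natAbs_natCast]; exact (hN1 i).1)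
    omega
  · apply h2
    funext i
    have hz : k' i + ℓ i = 0 :=
      Int.eq_zero_of_dvd_of_natAbs_lt_natAbs (hd i) (by rw [Int.natAbs_natCast]; exact (hN1 i).2)
    rw [Pi.neg_apply]
    omega

/-- **The energy of the effective solution is carried by the pair**: `∫‖v r‖² = 2 Σᵢ |modeCoeff ℓ (v r) i|²` for a.e. `r ∈ (0,T')`
(`ℓ ≠ 0`). [folklore] -/
theorem carrierFree_integral_norm_sq_eq {𝔹 : Torus.Visc4 (Fin 3)} {lo' hi' : ℝ} (hN : Torus.NearIso 𝔹 lo' hi') (hlo' : 0 < lo')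
    {ℓ : Fin 3 → ℤ} (hℓ : ℓ ≠ 0) (p : EuclideanSpace ℝ (Fin 3)) {T' : ℝ} {v : ℝ → VF}
    (hv : Torus.IsWeakTensorPassiveVectorOn 0 T' 𝔹 (fun _ _ => 0) (fun x => (UnitAddTorus.mFourier ℓ x).re • p) v) :
    ∀ᵐ r ∂(volume.restrict (Ioo 0 T')), ∫ x, ‖v r x‖ ^ 2 = 2 * ∑ i, ‖modeCoeff ℓ (v r) i‖ ^ 2 := by
  filter_upwards [carrierFree_mFourierCoeff_eq_zero hN hlo' ℓ p hv, hv.ae_memLp_two] with r hr hr2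
  exact integral_norm_sq_eq_two_mul_sum hr2 hℓ hr

end Effective

/-! ## §3 The cell solution: the fast complement of the pair -/

section Cell

/-- **Fast complement of a slow-datum cell solution, pair form** (`ae_complement_pair_energy_le` along the cell carrier): for the design
`W.stretch M`, cell viscosity `ν > 0`, `n ≥ 1` cells, a tensor `𝔸` with `NearIso 𝔸 (ν lo/λ) (ν hi λ)` (`lo, λ > 0`), a mode `ℓ ≠ 0` with
`2|ℓᵢ| ≤ n` and `p ⊥ ℓ`, every weak cell solution `w` from `Re e_ℓ·p` satisfies, for a.e. `t ∈ (0,T)`,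
`∫‖w t‖² − 2Σᵢ|modeCoeff ℓ (w t) i|² ≤ (3·(k/(2πn))·(2π‖ℓ‖))²·E₀ / (4π²·(νlo/(λn²))·(n²/4))²` (`= 9k²λ²‖ℓ‖²E₀/(π⁴n²ν²lo²)`). [folklore] -/
theorem cell_pair_complement_le {k : ℕ} (W : LatticeWord k) (M : ℝ) (hM : 0 < M) {lo hi lam ν : ℝ} (hlo : 0 < lo)
    (hlam : 0 < lam) (hν : 0 < ν) {n : ℕ} (hn : 0 < n) {𝔸 : Torus.Visc4 (Fin 3)}
    (hA : Torus.NearIso 𝔸 (ν * (lo / lam)) (ν * (hi * lam))) {ℓ : Fin 3 → ℤ} (hℓ : ℓ ≠ 0) (hℓi : ∀ i, 2 * |(ℓ i : ℝ)| ≤ n)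
    {p : EuclideanSpace ℝ (Fin 3)} (hpℓ : ⟪p, Torus.latticeVec ℓ⟫_ℝ = 0) {T : ℝ} {w : ℝ → VF}
    (hw : Torus.IsWeakTensorPassiveVectorOn 0 T ((1 / (n:ℝ) ^ 2) • 𝔸) (cellField W M hM ν hν n)
      (fun x => (UnitAddTorus.mFourier ℓ x).re • p) w) :
    ∀ᵐ t ∂(volume.restrict (Ioo 0 T)),
      (∫ x, ‖w t x‖ ^ 2) - 2 * ∑ i, ‖modeCoeff ℓ (w t) i‖ ^ 2 ≤
        (3 * ((k:ℝ) / (2 * Real.pi * n)) * (2 * Real.pi * ‖Torus.latticeVec ℓ‖)) ^ 2 *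
            (∫ x, ‖(UnitAddTorus.mFourier ℓ x).re • p‖ ^ 2) /
          (4 * Real.pi ^ 2 * ((1 / (n:ℝ) ^ 2) * (ν * (lo / lam))) * ((n:ℝ) ^ 2 / 4)) ^ 2 := by
  have hN : Torus.NearIso ((1 / (n:ℝ) ^ 2) • 𝔸) ((1 / (n:ℝ) ^ 2) * (ν * (lo / lam))) ((1 / (n:ℝ) ^ 2) * (ν * (hi * lam))) :=
    hA.smul (by positivity)
  have hlo' : 0 < (1 / (n:ℝ) ^ 2) * (ν * (lo / lam)) := by positivity
  have hb : MemLp (FunctionSpaces.Torus.stLift (cellField W M hM ν hν n)) ∞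
      (volume.restrict (Ioo 0 T ×ˢ (univ : Set (EuclideanSpace ℝ (Fin 3))))) := by
    unfold cellField
    exact memLp_top_stLift_cell _ n T
  have hbsup : ∀ s x, ‖cellField W M hM ν hν n s x‖ ≤ (k:ℝ) / (2 * Real.pi * n) := fun s x => by
    unfold cellField; exact norm_cell_le_div _ hn s x
  have hper : ∀ (j : Fin 3 → Fin n) (s : ℝ) (x : UnitAddTorus (Fin 3)),
      cellField W M hM ν hν n s (x + fun i => ((((j i : ℕ) : ℝ) / n : ℝ) : UnitAddCircle)) = cellField W M hM ν hν n s x :=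
    fun j s x => by unfold cellField; exact cell_add_grid _ hn j s x
  have hw₀2 : MemLp (fun x : UnitAddTorus (Fin 3) => (UnitAddTorus.mFourier ℓ x).re • p) 2 volume :=
    memLp_two_of_memSobolev_one_complexify (memSobolev_one_singleMode ℓ p)
  have hdiv₀ : FunctionSpaces.Torus.IsWeaklyDivFree (fun x : UnitAddTorus (Fin 3) => (UnitAddTorus.mFourier ℓ x).re • p) :=
    isWeaklyDivFree_singleMode ℓ hpℓ
  have hsupp₀ : ∀ k' : Fin 3 → ℤ, k' ≠ ℓ → k' ≠ -ℓ →
      mFourierCoeff (FunctionSpaces.EuclideanSpace.complexify ∘ fun x : UnitAddTorus (Fin 3) => (UnitAddTorus.mFourier ℓ x).re • p) k' = 0 :=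
    fun k' h1 h2 => mFourierCoeff_singleMode_eq_zero ℓ p h1 h2
  have hmain := ae_complement_pair_energy_le k n hn (cellField W M hM ν hν n) T hb hbsup hper ((1 / (n:ℝ) ^ 2) • 𝔸) _ _ hN hlo'
    ℓ hℓ hℓi _ hw₀2 hdiv₀ hsupp₀ w hw
  filter_upwards [hmain, hw.ae_memLp_two] with t ht ht2
  rw [← pair_energy_eq_two_mul_sum (ht2.integrable one_le_two)]
  exact ht

/-- The constant of `cell_pair_complement_le` in closed form: `9k²λ²‖ℓ‖²E₀/(π⁴n²ν²lo²)`. [folklore] -/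
theorem cell_pair_complement_const_eq {k n : ℕ} (hn : 0 < n) {lo lam ν : ℝ} (hlo : 0 < lo) (hlam : 0 < lam) (hν : 0 < ν)
    (ℓ : Fin 3 → ℤ) (E₀ : ℝ) :
    (3 * ((k:ℝ) / (2 * Real.pi * n)) * (2 * Real.pi * ‖Torus.latticeVec ℓ‖)) ^ 2 * E₀ /
        (4 * Real.pi ^ 2 * ((1 / (n:ℝ) ^ 2) * (ν * (lo / lam))) * ((n:ℝ) ^ 2 / 4)) ^ 2
      = 9 * (k:ℝ) ^ 2 * lam ^ 2 * ‖Torus.latticeVec ℓ‖ ^ 2 * E₀ / (Real.pi ^ 4 * (n:ℝ) ^ 2 * ν ^ 2 * lo ^ 2) := by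
  have hn' : (0:ℝ) < n := by exact_mod_cast hn
  have hπ := Real.pi_pos
  field_simp
  ring

end Cell

/-! ## §4 The reduction: `L²` distance = slow-pair distance + corrector content -/

section Reduction

/-- **Parseval split of the difference.**  If `v r` has no modes off `{±ℓ}` then, for `w t, v r ∈ L²`,
`∫‖w t − v r‖² = 2Σᵢ|modeCoeff ℓ (w t − v r) i|² + (∫‖w t‖² − 2Σᵢ|modeCoeff ℓ (w t) i|²)`: the `L²` error splits into the slow-pair error and the
fast content of `w t`, which the difference inherits unchanged. [folklore] -/
theorem integral_norm_sq_sub_eq_of_pair {f g : VF} (hf : MemLp f 2 volume) (hg : MemLp g 2 volume) {ℓ : Fin 3 → ℤ} (hℓ : ℓ ≠ 0)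
    (hz : ∀ k', k' ≠ ℓ → k' ≠ -ℓ → mFourierCoeff (FunctionSpaces.EuclideanSpace.complexify ∘ g) k' = 0) :
    ∫ x, ‖f x - g x‖ ^ 2 = 2 * ∑ i, ‖modeCoeff ℓ (fun x => f x - g x) i‖ ^ 2 +
      ((∫ x, ‖f x‖ ^ 2) - 2 * ∑ i, ‖modeCoeff ℓ f i‖ ^ 2) := by
  classical
  have hfi : Integrable f volume := hf.integrable one_le_two
  have hgi : Integrable g volume := hg.integrable one_le_two
  have hd : MemLp (fun x => f x - g x) 2 volume := hf.sub hg
  have hdi : Integrable (fun x => f x - g x) volume := hd.integrable one_le_two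
  have hne := CellEnergyT.ne_neg_of_ne_zero hℓ
  set cf : (Fin 3 → ℤ) → EuclideanSpace ℂ (Fin 3) := fun k' => mFourierCoeff (FunctionSpaces.EuclideanSpace.complexify ∘ f) k'
    with hcf
  set cd : (Fin 3 → ℤ) → EuclideanSpace ℂ (Fin 3) :=
    fun k' => mFourierCoeff (FunctionSpaces.EuclideanSpace.complexify ∘ fun x => f x - g x) k' with hcd
  -- off the pair the difference has the coefficients of `f`
  have hoff : ∀ k', k' ≠ ℓ → k' ≠ -ℓ → cd k' = cf k' := by
    intro k' h1 h2
    have hsub : (FunctionSpaces.EuclideanSpace.complexify ∘ fun x => f x - g x)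
        = (FunctionSpaces.EuclideanSpace.complexify ∘ f) - (FunctionSpaces.EuclideanSpace.complexify ∘ g) := by
      funext x
      simp only [Function.comp_apply, Pi.sub_apply, map_sub]
    rw [hcd, hcf]
    simp only
    rw [hsub, FunctionSpaces.Torus.mFourierCoeff_sub (FunctionSpaces.Torus.integrable_complexify_comp hfi)
      (FunctionSpaces.Torus.integrable_complexify_comp hgi), hz k' h1 h2, sub_zero]
  have hPf := FunctionSpaces.Torus.hasSum_sq_norm_mFourierCoeff_complexify hf
  have hPd := FunctionSpaces.Torus.hasSum_sq_norm_mFourierCoeff_complexify hd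
  have hdiff : HasSum (fun k' => ‖cd k'‖ ^ 2 - ‖cf k'‖ ^ 2) ((∫ x, ‖f x - g x‖ ^ 2) - ∫ x, ‖f x‖ ^ 2) := hPd.sub hPf
  have hfin : HasSum (fun k' => ‖cd k'‖ ^ 2 - ‖cf k'‖ ^ 2)
      (∑ k' ∈ ({ℓ, -ℓ} : Finset (Fin 3 → ℤ)), (‖cd k'‖ ^ 2 - ‖cf k'‖ ^ 2)) := by
    refine hasSum_sum_of_ne_finset_zero fun k' hk' => ?_
    have h1 : k' ≠ ℓ := fun h => hk' (h ▸ Finset.mem_insert_self _ _)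
    have h2 : k' ≠ -ℓ := fun h => hk' (h ▸ Finset.mem_insert_of_mem (Finset.mem_singleton_self _))
    rw [hoff k' h1 h2, sub_self]
  have heq := hdiff.unique hfin
  rw [Finset.sum_pair hne] at heq
  have hpd := pair_energy_eq_two_mul_sum hdi ℓ
  have hpf := pair_energy_eq_two_mul_sum hfi ℓ
  simp only [hcd, hcf] at heq
  linarith

/-- **SECTOR REDUCTION OF THE SLOW-VECTOR CLAUSE (identity).**  In the setting of `SlowVectorClauseNoExF` — `w` a weak cell solution (tensor
`(1/n²)•𝔸` along `cellField W M hM ν _ n`) and `v` a weak solution of an elliptic constant tensor `𝔹` with no carrier on a horizon `T' ≥ T`, both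
from `Re e_ℓ·p`, `ℓ ≠ 0` — for a.e. `t ∈ (0,T)`:
`∫‖w t − v t‖² = 2Σᵢ|modeCoeff ℓ (w t − v t) i|² + (∫‖w t‖² − 2Σᵢ|modeCoeff ℓ (w t) i|²)`. [folklore] -/
theorem slowVector_integral_norm_sq_sub_eq {k : ℕ} (W : LatticeWord k) (M : ℝ) (hM : 0 < M) {ν : ℝ} (hν : 0 < ν) (n : ℕ)
    (𝔸 : Torus.Visc4 (Fin 3)) {𝔹 : Torus.Visc4 (Fin 3)} {lo' hi' : ℝ} (hN : Torus.NearIso 𝔹 lo' hi') (hlo' : 0 < lo')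
    {ℓ : Fin 3 → ℤ} (hℓ : ℓ ≠ 0) (p : EuclideanSpace ℝ (Fin 3)) {T T' : ℝ} (hTT' : T ≤ T') {w v : ℝ → VF}
    (hw : Torus.IsWeakTensorPassiveVectorOn 0 T ((1 / (n:ℝ) ^ 2) • 𝔸) (cellField W M hM ν hν n)
      (fun x => (UnitAddTorus.mFourier ℓ x).re • p) w)
    (hv : Torus.IsWeakTensorPassiveVectorOn 0 T' 𝔹 (fun _ _ => 0) (fun x => (UnitAddTorus.mFourier ℓ x).re • p) v) :
    ∀ᵐ t ∂(volume.restrict (Ioo 0 T)),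
      ∫ x, ‖w t x - v t x‖ ^ 2 = 2 * ∑ i, ‖modeCoeff ℓ (fun x => w t x - v t x) i‖ ^ 2 +
        ((∫ x, ‖w t x‖ ^ 2) - 2 * ∑ i, ‖modeCoeff ℓ (w t) i‖ ^ 2) := by
  have hsub : Ioo 0 T ⊆ Ioo 0 T' := Ioo_subset_Ioo_right hTT'
  have hv0 := ae_restrict_of_ae_restrict_of_subset hsub (carrierFree_mFourierCoeff_eq_zero hN hlo' ℓ p hv)
  have hv2 := ae_restrict_of_ae_restrict_of_subset hsub hv.ae_memLp_two
  filter_upwards [hw.ae_memLp_two, hv0, hv2] with t hw2 hvz hv2'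
  exact integral_norm_sq_sub_eq_of_pair hw2 hv2' hℓ hvz

/-- **SECTOR REDUCTION OF THE SLOW-VECTOR CLAUSE (sandwich).**  Same setting, with the window `NearIso 𝔸 (ν lo/λ) (ν hi λ)`, `2|ℓᵢ| ≤ n`,
`p ⊥ ℓ`: for a.e. `t ∈ (0,T)`,
`2Σᵢ|modeCoeff ℓ (w t − v t) i|² ≤ ∫‖w t − v t‖² ≤ 2Σᵢ|modeCoeff ℓ (w t − v t) i|² + (9k²λ²‖ℓ‖²/(π⁴n²ν²lo²))·∫‖Re e_ℓ·p‖²` — the left-hand side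
of clause (V) is the `L²` distance to the effective solution up to the corrector content (C). [folklore] -/
theorem slowVector_sandwich {k : ℕ} (W : LatticeWord k) (M : ℝ) (hM : 0 < M) {lo hi lam ν : ℝ} (hlo : 0 < lo)
    (hlam : 0 < lam) (hν : 0 < ν) {n : ℕ} (hn : 0 < n) {𝔸 : Torus.Visc4 (Fin 3)}
    (hA : Torus.NearIso 𝔸 (ν * (lo / lam)) (ν * (hi * lam))) {𝔹 : Torus.Visc4 (Fin 3)} {lo' hi' : ℝ}
    (hN : Torus.NearIso 𝔹 lo' hi') (hlo' : 0 < lo') {ℓ : Fin 3 → ℤ} (hℓ : ℓ ≠ 0) (hℓi : ∀ i, 2 * |(ℓ i : ℝ)| ≤ n)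
    {p : EuclideanSpace ℝ (Fin 3)} (hpℓ : ⟪p, Torus.latticeVec ℓ⟫_ℝ = 0) {T T' : ℝ} (hTT' : T ≤ T') {w v : ℝ → VF}
    (hw : Torus.IsWeakTensorPassiveVectorOn 0 T ((1 / (n:ℝ) ^ 2) • 𝔸) (cellField W M hM ν hν n)
      (fun x => (UnitAddTorus.mFourier ℓ x).re • p) w)
    (hv : Torus.IsWeakTensorPassiveVectorOn 0 T' 𝔹 (fun _ _ => 0) (fun x => (UnitAddTorus.mFourier ℓ x).re • p) v) :
    ∀ᵐ t ∂(volume.restrict (Ioo 0 T)),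
      2 * ∑ i, ‖modeCoeff ℓ (fun x => w t x - v t x) i‖ ^ 2 ≤ ∫ x, ‖w t x - v t x‖ ^ 2 ∧
      ∫ x, ‖w t x - v t x‖ ^ 2 ≤ 2 * ∑ i, ‖modeCoeff ℓ (fun x => w t x - v t x) i‖ ^ 2 +
        9 * (k:ℝ) ^ 2 * lam ^ 2 * ‖Torus.latticeVec ℓ‖ ^ 2 * (∫ x, ‖(UnitAddTorus.mFourier ℓ x).re • p‖ ^ 2) /
          (Real.pi ^ 4 * (n:ℝ) ^ 2 * ν ^ 2 * lo ^ 2) := by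
  have hsub : Ioo 0 T ⊆ Ioo 0 T' := Ioo_subset_Ioo_right hTT'
  have hv2 := ae_restrict_of_ae_restrict_of_subset hsub hv.ae_memLp_two
  filter_upwards [slowVector_integral_norm_sq_sub_eq W M hM hν n 𝔸 hN hlo' hℓ p hTT' hw hv,
    cell_pair_complement_le W M hM hlo hlam hν hn hA hℓ hℓi hpℓ hw, hw.ae_memLp_two, hv2] with t heq hC hw2 hv2'
  refine ⟨two_mul_sum_modeCoeff_le_integral (hw2.sub hv2') hℓ, ?_⟩
  rw [heq, ← cell_pair_complement_const_eq hn hlo hlam hν ℓ]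
  linarith

end Reduction

end Summit.AnomalousDissipation.AnomalousDissipation.Theorems.SolenoidalFractalHomogenisation.LagrangianStep

end
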